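import Mathlib.LinearAlgebra.Matrix.Rank
import Mathlib.LinearAlgebra.Matrix.Notation
import Summits.HodgeConjecture.HodgeConjecture.Theorems.Ring2HabitatCMSurfaceTripleDatum

/-!
# Ring 2 · Habitat (seat `habitat2`, gen 29) — the D₄ triple of CM abelian surfaces, II: Mumford–Tate ranks

HONEST FRAMING (cell `pub-hodge-ring2`, verbatim): research route conditional on HC_CM; not a corollary;
Q11.4-sentence-2 already refuted in dim ≥ 3.  `HC_CM` (`Theses.RankFourFaces.CMAbelianHodge`) does not occur in this
file; NO case of the Hodge conjecture is claimed or refuted here; no named fact, no `sorry`, standard axioms.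
Dictionary, status words and provenance: module docstring of `Ring2HabitatCMSurfaceTripleDatum` (imported).

DICTIONARY ITEM (NOT formalised).  `M Φ` is the `8 × 12` matrix over `ℚ` whose row `g` is the indicator of `gΦ`.  By
[cite: Deligne1982HodgeCycles, §3, Example 3.7] the cocharacter group `X_*(MT(A_Φ)) ⊗ ℚ ⊂ ℚ[S]` is the `ℚ`-span of
these rows, so `rank MT(A_Φ) = rank (M Φ)` and `dim Hg(A_Φ) = rank (M Φ) - 1`; restricting the columns to the blocks
of a sub-product gives the Mumford–Tate group of that sub-product (image torus).  Generic value for three pairwise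
non-isogenous CM abelian surfaces: `rank MT = 1 + 2 + 2 + 2 = 7`, `dim Hg = 6`.

WHAT IS PROVED (kernel) / READ (dictionary):
* `dependency_all`, `rank_M_le_five_all`, `rank_M_eq_five_all`: for EVERY CM type `Φ` of `S` (all 64) the eight rows
  satisfy the three universal relations `row(cg) = row(1) + row(c) - row(g)` (`E8`) and `rank (M Φ) = 5`.  READ:
  `rank MT(S₁ × S₂ × S₃) = 5 < 7`, `dim Hg = 4 < 6`, for every product of CM surfaces with CM by `(K, K, Kʳ)`,
  whatever the three types (HABITATS §B31.3 (ii); the general bound `rank ≤ 1 + |G|/2` is §B31.L).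
* `ranks_phi`: for `phi` the column restrictions to `A ⊔ B`, `A ⊔ C`, `B ⊔ C` have rank `5 = 1+2+2` and to `A`, `B`,
  `C` rank `3`.  READ: `Hg(Sᵢ × Sⱼ) = Hg(Sᵢ) × Hg(Sⱼ)` for EACH of the three pairs, while `Hg(S₁×S₂×S₃) → Hg(Sᵢ × Sⱼ)`
  is an isogeny: pairwise Hodge-independent, jointly degenerate.  `ranks_phiCtrl`: for the control `A ⊔ B` has rank
  `3` (`S₂ ~ S₁`: `Hg(S₁ × S̄₁) = Hg(S₁)`), `A ⊔ C`, `B ⊔ C` rank `5`, total `5`.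
* Transport `M_translate`, `M_image_aut`, `rank_M_orbit_le`: the rank is an invariant of the `G × Aut_G(S)`-orbit,
  which is how the two representatives give all 64 types.
The rank identities are certified by explicit rational matrices: `E * M[ρ] = M` bounds the rank above
(`rank_le_of_dep`), `M[ρ] * Q = 1` below (`le_rank_of_rinv`).

## References (bib keys of `references.bib`)

* [cite: GaoUllmo2025, Thm 3.1] Z. Gao, E. Ullmo, J. Inst. Math. Jussieu 25 (2025) = arXiv:2411.12249 (tree:
  `Literature.AlgebraicGeometry.GaoUllmo2025.theorem31`, `theorem31_finrank`).
* [cite: Pohlmann1968, Thm 1] H. Pohlmann, Ann. of Math. (2) 88 (1968) 161–180.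
* [cite: Deligne1982HodgeCycles, §3] P. Deligne (notes by J. S. Milne), Hodge cycles on abelian varieties, LNM 900.
* [cite: Shimura1998, §8] G. Shimura, Abelian varieties with complex multiplication and modular functions, 1998.
* [cite: MoonenZarhin1999LowDim, Thm 0.1] B. Moonen, Yu. Zarhin, Math. Ann. 315 (1999) 711–733.
* [cite: RamonMari2008, Prop. 2.18] J. J. Ramón Marí, Collect. Math. 59 (2008) 1–26 = arXiv:math/0505357.
* [cite: Lombardo2016, Cor. 1.2] D. Lombardo, Ann. Inst. Fourier 66 (2016) 1217–1245 (Cor. 1.2 = Cor. 4.5, Rem. 4.6).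
* [cite: Moonen2017FamiliesMotives, §3.3] B. Moonen, Milan J. Math. 85 (2017) 257–307.
-/

set_option linter.dupNamespace false

namespace Summit.HodgeConjecture.HodgeConjecture.Ring2.Habitat.CMSurfaceTriple

open Finset

/-! ### §E. Mumford–Tate ranks -/

/-- The cocharacter matrix of a type: row `g` = indicator of `gΦ` (READ, dictionary of `…Datum`: its row span is
`X_*(MT(A_Φ)) ⊗ ℚ`).
[Deligne1982HodgeCycles, §3, Example 3.7] -/
def M (Φ : Finset (Fin 12)) : Matrix (Fin 8) (Fin 12) ℚ :=
  Matrix.of fun g x => if x ∈ translate g Φ then 1 else 0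

/-- Rows `1, r, c, s, rs` — a basis of the row space in rank `5`. [folklore] -/
def sel5 : Fin 5 → Fin 8 := ![0, 1, 2, 4, 5]
/-- Rows `1, r, c` — a basis in rank `3`. [folklore] -/
def sel3 : Fin 3 → Fin 8 := ![0, 1, 2]

/-- The universal dependency: `row(r³) = row(1) + row(c) - row(r)`, `row(cs) = row(1) + row(c) - row(s)`,
`row(csr… ) …` — i.e. `row(cg) = 𝟙 - row(g)` with `𝟙 = row(1) + row(c)`. [folklore] -/
def E8 : Matrix (Fin 8) (Fin 5) ℚ :=
  !![1, 0, 0, 0, 0;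
    0, 1, 0, 0, 0;
    0, 0, 1, 0, 0;
    1, -1, 1, 0, 0;
    0, 0, 0, 1, 0;
    0, 0, 0, 0, 1;
    1, 0, 1, -1, 0;
    1, 0, 1, 0, -1]

/-- Column selections: the blocks of the sub-products. [folklore] -/
def colAB : Fin 8 → Fin 12 := ![0, 1, 2, 3, 4, 5, 6, 7]
/-- [folklore] -/
def colAC : Fin 8 → Fin 12 := ![0, 1, 2, 3, 8, 9, 10, 11]
/-- [folklore] -/
def colBC : Fin 8 → Fin 12 := ![4, 5, 6, 7, 8, 9, 10, 11]
/-- [folklore] -/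
def colA : Fin 4 → Fin 12 := ![0, 1, 2, 3]
/-- [folklore] -/
def colB : Fin 4 → Fin 12 := ![4, 5, 6, 7]
/-- [folklore] -/
def colC : Fin 4 → Fin 12 := ![8, 9, 10, 11]

/-- RANK BOOKKEEPING (any field): a dependency certificate bounds the rank above. -/
theorem rank_le_of_dep {k m n : ℕ} (A : Matrix (Fin m) (Fin n) ℚ) (ρ : Fin k → Fin m)
    (E : Matrix (Fin m) (Fin k) ℚ) (hE : E * A.submatrix ρ id = A) : A.rank ≤ k :=
  calc A.rank = (E * A.submatrix ρ id).rank := by rw [hE]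
    _ ≤ E.rank := Matrix.rank_mul_le_left _ _
    _ ≤ k := Matrix.rank_le_width E

/-- RANK BOOKKEEPING: a right inverse of `k` selected rows bounds the rank below. -/
theorem le_rank_of_rinv {k m n : ℕ} (A : Matrix (Fin m) (Fin n) ℚ) (ρ : Fin k → Fin m)
    (Q : Matrix (Fin n) (Fin k) ℚ) (hQ : A.submatrix ρ id * Q = 1) : k ≤ A.rank :=
  calc k = (1 : Matrix (Fin k) (Fin k) ℚ).rank := by rw [Matrix.rank_one, Fintype.card_fin]
    _ = (A.submatrix ρ id * Q).rank := by rw [hQ]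
    _ ≤ (A.submatrix ρ id).rank := Matrix.rank_mul_le_left _ _
    _ ≤ A.rank := Matrix.rank_submatrix_le _ _ _

/-- Both certificates: the rank is `k`. -/
theorem rank_eq_of_cert {k m n : ℕ} (A : Matrix (Fin m) (Fin n) ℚ) (ρ : Fin k → Fin m)
    (E : Matrix (Fin m) (Fin k) ℚ) (Q : Matrix (Fin n) (Fin k) ℚ)
    (hE : E * A.submatrix ρ id = A) (hQ : A.submatrix ρ id * Q = 1) : A.rank = k :=
  le_antisymm (rank_le_of_dep A ρ E hE) (le_rank_of_rinv A ρ Q hQ)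

set_option maxRecDepth 8000 in
set_option maxHeartbeats 4000000 in
/-- The universal dependency holds for all 64 CM types. -/
theorem dependency_all : ∀ Φ ∈ cmTypes, E8 * (M Φ).submatrix sel5 id = M Φ := by
  have h : cmTypes.filter (fun Φ => E8 * (M Φ).submatrix sel5 id = M Φ) = cmTypes := by decide +kernel
  exact Finset.filter_eq_self.mp h

/-- (i) `rank MT(A_Φ) ≤ 5` (`dim Hg ≤ 4 < 6`) for EVERY CM type of `K × K × Kʳ` (HABITATS §B31.L at `|G| = 8`). -/
theorem rank_M_le_five_all : ∀ Φ ∈ cmTypes, (M Φ).rank ≤ 5 :=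
  fun Φ hΦ => rank_le_of_dep (M Φ) sel5 E8 (dependency_all Φ hΦ)

/-- `translate` is multiplicative (the action law on sets). -/
theorem translate_mul (g h : Fin 8) (P : Finset (Fin 12)) :
    translate (mul g h) P = translate g (translate h P) := by
  simp only [translate, Finset.image_image]
  congr 1
  funext x
  simp [Function.comp, act_laws.2.1]

/-- Relabellings commute with translation. -/
theorem translate_image_aut (g : Fin 8) (a : Fin 16) (P : Finset (Fin 12)) :
    translate g (P.image (aut a)) = (translate g P).image (aut a) := by
  simp only [translate, Finset.image_image]
  congr 1
  funext x
  simp [Function.comp, aut_act]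

/-- Galois conjugation permutes the rows. -/
theorem M_translate (h : Fin 8) (Φ : Finset (Fin 12)) :
    M (translate h Φ) = (M Φ).submatrix (fun g => mul g h) id := by
  ext g x
  simp only [M, Matrix.submatrix_apply, Matrix.of_apply, id, translate_mul]

/-- A relabelling of `S` permutes the columns. -/
theorem M_image_aut (a : Fin 16) (Φ : Finset (Fin 12)) :
    M (Φ.image (aut a)) = (M Φ).submatrix id (aut (autInv a)) := by
  ext g x
  have key : x ∈ (translate g Φ).image (aut a) ↔ aut (autInv a) x ∈ translate g Φ := by
    constructor
    · intro hx
      obtain ⟨y, hy, hyx⟩ := Finset.mem_image.mp hx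
      rw [← hyx, autInv_aut]
      exact hy
    · intro hx
      exact Finset.mem_image.mpr ⟨_, hx, aut_autInv a x⟩
  simp only [M, Matrix.submatrix_apply, Matrix.of_apply, id, translate_image_aut, key]

/-- Hence the rank of `M` does not increase along `G × Aut_G(S)`-orbits (so is constant on them). -/
theorem rank_M_orbit_le (g : Fin 8) (a : Fin 16) (Φ : Finset (Fin 12)) :
    (M (translate g (Φ.image (aut a)))).rank ≤ (M Φ).rank := by
  rw [M_translate, M_image_aut, Matrix.submatrix_submatrix]
  exact Matrix.rank_submatrix_le _ _ _

/-! #### Certificates for the representative `phi` and the control -/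

/-- [folklore] -/
def Q_phi : Matrix (Fin 12) (Fin 5) ℚ :=
  !![0, -1, 1, 0, 1; 1, 0, 0, -1, 0; 0, 0, 1, 0, 0; 0, 0, 0, 0, 0; 0, 0, 0, 0, 0; 0, 0, 0, 0, 0;
    0, 0, 0, 0, 0; 0, 0, 0, 0, 0; 1, 0, 0, 0, -1; -1, 1, -1, 1, 0; 0, 0, 0, 0, 0; 0, 0, 0, 0, 0]
/-- [folklore] -/
def Q_phi_AB : Matrix (Fin 8) (Fin 5) ℚ :=
  !![1, -1, 1, 0, 0; 0, 1/2, -1/2, -1/2, 1/2; 1, -1/2, 3/2, -1/2, -1/2; 0, 0, 0, 0, 0;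
    0, 1/2, -1/2, 1/2, -1/2; -1, 1/2, -1/2, 1/2, 1/2; 0, 0, 0, 0, 0; 0, 0, 0, 0, 0]
/-- [folklore] -/
def Q_phi_AC : Matrix (Fin 8) (Fin 5) ℚ :=
  !![0, -1, 1, 0, 1; 1, 0, 0, -1, 0; 0, 0, 1, 0, 0; 0, 0, 0, 0, 0;
    1, 0, 0, 0, -1; -1, 1, -1, 1, 0; 0, 0, 0, 0, 0; 0, 0, 0, 0, 0]
/-- [folklore] -/
def Q_phi_BC : Matrix (Fin 8) (Fin 5) ℚ :=
  !![1, 1, 1, -1, -1; -1, 0, 0, 1, 0; 1, 0, 1, -1, 0; 0, 0, 0, 0, 0;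
    0, -1, 0, 1, 0; 0, 0, -1, 0, 1; 0, 0, 0, 0, 0; 0, 0, 0, 0, 0]
/-- [folklore] -/
def Q_K : Matrix (Fin 4) (Fin 3) ℚ := !![1, -1, 1; 0, 1, -1; 0, 0, 1; 0, 0, 0]
/-- [folklore] -/
def Q_K' : Matrix (Fin 4) (Fin 3) ℚ := !![1, 0, 0; -1, 1, 0; 1, -1, 1; 0, 0, 0]
/-- [folklore] -/
def E_K : Matrix (Fin 8) (Fin 3) ℚ := !![1, 0, 0; 0, 1, 0; 0, 0, 1; 1, -1, 1; 1, -1, 1; 1, 0, 0; 0, 1, 0; 0, 0, 1]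
/-- [folklore] -/
def E_K' : Matrix (Fin 8) (Fin 3) ℚ := !![1, 0, 0; 0, 1, 0; 0, 0, 1; 1, -1, 1; 0, 1, 0; 0, 0, 1; 1, -1, 1; 1, 0, 0]
/-- [folklore] -/
def E_Kr : Matrix (Fin 8) (Fin 3) ℚ := !![1, 0, 0; 0, 1, 0; 0, 0, 1; 1, -1, 1; 1, 0, 0; 0, 1, 0; 0, 0, 1; 1, -1, 1]
/-- [folklore] -/
def Q_ctrl : Matrix (Fin 12) (Fin 5) ℚ :=
  !![0, -1, 1, 0, 1; 1, 0, 0, -1, 0; 0, 0, 1, 0, 0; 0, 0, 0, 0, 0; 0, 0, 0, 0, 0; 0, 0, 0, 0, 0;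
    0, 0, 0, 0, 0; 0, 0, 0, 0, 0; 1, 0, 0, 0, -1; -1, 1, -1, 1, 0; 0, 0, 0, 0, 0; 0, 0, 0, 0, 0]
/-- [folklore] -/
def Q_ctrl_AB : Matrix (Fin 8) (Fin 3) ℚ := !![1, -1, 1; 0, 1, -1; 0, 0, 1; 0, 0, 0; 0, 0, 0; 0, 0, 0; 0, 0, 0; 0, 0, 0]
/-- [folklore] -/
def Q_ctrl_BC : Matrix (Fin 8) (Fin 5) ℚ :=
  !![1, 0, 1, -1, 0; -1, 0, 0, 1, 0; 1, -1, 1, -1, 1; 0, 0, 0, 0, 0;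
    1, 0, 0, 0, -1; -1, 1, -1, 1, 0; 0, 0, 0, 0, 0; 0, 0, 0, 0, 0]

set_option maxRecDepth 8000 in
set_option maxHeartbeats 4000000 in
/-- (i)+(ii) for the representative: `rank MT(S₁×S₂×S₃) = 5`; pairs `A⊔B`, `A⊔C`, `B⊔C`: `5` (= `1+2+2`, i.e.
`Hg(Sᵢ×Sⱼ) = Hg(Sᵢ)×Hg(Sⱼ)`); singles `3`.  So `Hg(X) → Hg(Sᵢ × Sⱼ)` is an isogeny for each pair and
`dim Hg(X) = 4 < 6`. -/
theorem ranks_phi :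
    (M phi).rank = 5 ∧ ((M phi).submatrix id colAB).rank = 5 ∧ ((M phi).submatrix id colAC).rank = 5 ∧
    ((M phi).submatrix id colBC).rank = 5 ∧ ((M phi).submatrix id colA).rank = 3 ∧
    ((M phi).submatrix id colB).rank = 3 ∧ ((M phi).submatrix id colC).rank = 3 := by
  refine ⟨rank_eq_of_cert _ sel5 E8 Q_phi (by decide +kernel) (by decide +kernel),
    rank_eq_of_cert _ sel5 E8 Q_phi_AB (by decide +kernel) (by decide +kernel),
    rank_eq_of_cert _ sel5 E8 Q_phi_AC (by decide +kernel) (by decide +kernel),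
    rank_eq_of_cert _ sel5 E8 Q_phi_BC (by decide +kernel) (by decide +kernel),
    rank_eq_of_cert _ sel3 E_K Q_K (by decide +kernel) (by decide +kernel),
    rank_eq_of_cert _ sel3 E_K' Q_K' (by decide +kernel) (by decide +kernel),
    rank_eq_of_cert _ sel3 E_Kr Q_K (by decide +kernel) (by decide +kernel)⟩

set_option maxRecDepth 8000 in
set_option maxHeartbeats 4000000 in
/-- CONTROL (`S₂' ~ S₁`): total rank still `5`, but the pair `A ⊔ B` has rank `3` (`Hg(S₁ × S̄₁) = Hg(S₁)`), `A ⊔ C`,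
`B ⊔ C` rank `5`. -/
theorem ranks_phiCtrl :
    (M phiCtrl).rank = 5 ∧ ((M phiCtrl).submatrix id colAB).rank = 3 ∧
    ((M phiCtrl).submatrix id colAC).rank = 5 ∧ ((M phiCtrl).submatrix id colBC).rank = 5 := by
  refine ⟨rank_eq_of_cert _ sel5 E8 Q_ctrl (by decide +kernel) (by decide +kernel),
    rank_eq_of_cert _ sel3 E_K Q_ctrl_AB (by decide +kernel) (by decide +kernel),
    rank_eq_of_cert _ sel5 E8 Q_phi_AC (by decide +kernel) (by decide +kernel),
    rank_eq_of_cert _ sel5 E8 Q_ctrl_BC (by decide +kernel) (by decide +kernel)⟩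

/-- (i) for ALL 64 types: `rank MT(A_Φ) = 5`, `dim Hg(A_Φ) = 4 < 6`, whatever the three CM types. -/
theorem rank_M_eq_five_all : ∀ Φ ∈ cmTypes, (M Φ).rank = 5 := by
  intro Φ hΦ
  refine le_antisymm (rank_M_le_five_all Φ hΦ) ?_
  obtain ⟨g, a, h⟩ := reaches_representative Φ hΦ
  have hle := rank_M_orbit_le g a Φ
  rcases h with h | h <;> rw [h] at hle
  · exact ranks_phi.1 ▸ hle
  · exact ranks_phiCtrl.1 ▸ hle

/-- The same rank as the dimension of the `ℚ`-span of the eight translates `𝟙_{gΦ}` (the form used in §0). -/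
theorem finrank_span_translates_phi :
    Module.finrank ℚ (Submodule.span ℚ (Set.range (M phi).row)) = 5 := by
  rw [← Matrix.rank_eq_finrank_span_row]; exact ranks_phi.1

end Summit.HodgeConjecture.HodgeConjecture.Ring2.Habitat.CMSurfaceTriple
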